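import Literature.MathematicalPhysics.QuantumLattice.PeriodicTrialState
import HarnessLib

/-!
# THE GIBBS VARIATIONAL PRINCIPLE FOR SUPERLATTICE-PERIODIC LATTICE-FERMION INTERACTIONS: the periodic variational pressure
# `P_q(β,Ψ) = sup_{ω q-periodic}[s̄(ω) − β ē_q(ω)]` IS the limit of the free-boundary box pressures along ALIGNED boxes, with two-sided windows

Topic `Literature/MathematicalPhysics/QuantumLattice` (family `hubbard`; crew hubbard-fast S2/S3 «T > 0 for decorated / multi-band / bilayer / staggered-field
models»). Periodic twin of `FermionGibbsVariationalPrinciple`: for a Hermitian, `q`-PERIODIC (`L_q = ⊕_i (q_i+1)ℤe_i`-covariant) interaction `Ψ` of finite range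
`R` on `ℤ^d` (`d ≥ 1`) — e.g. a one-band model in a STAGGERED field, the ionic Hubbard model, an Emery `CuO₂` plane or a bilayer presented by decoration, a
`z`-periodic stacking — and every real `β`:

* §1 **THE FINITE-VOLUME FLOOR** `le_perVarPressure_of_box`: for every ALIGNED `N ≥ 1` (`(q_i+1) ∣ N`),
  `(log Re Tr e^{−βH_{[0,N)^d}} + β Re(Ψ∅))/N^d − |β|·col_R(N)·S_q/N^d ≤ P_q(β,Ψ,R)` (the periodic trial state of `PeriodicTrialState` built on the box Gibbs
  state; periodic interactions are EVEN is NOT needed — evenness of `Ψ` is); with the cap of `PeriodicVariationalPressure`: the TWO-SIDED WINDOW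
  `|P_q(β,Ψ,R) − (log Re Z_N + β Re(Ψ∅))/N^d| ≤ |β| col_R(N) S_q(Ψ)/N^d` (`abs_perVarPressure_sub_boxLogPartitionFn_le`), `S_q` the cell site norm.
* §2 **THE LIMIT**: along the aligned boxes `N_k = k·Π_i(q_i+1)`, `N_k^{-d} log Re Z_{N_k} → P_q(β,Ψ,R)` for EVERY real `β` (`tendsto_boxLogPartitionFn_perVarPressure`);
  uniqueness of the limit makes `P_q` independent of the range parameter (`perVarPressure_eq_of_hasFiniteRange`).
* §3 consistency: for a translation-covariant `Ψ` this is `FermionGibbsVariationalPrinciple` again (`P_q = P = P_free`).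

Everything is PROVED; no definition, no named fact, no number. HONEST SCOPE: free boundary conditions along ALIGNED cubes; periodic equilibrium states
(maximisers of the periodic functional) and their Griffiths windows are the natural sequel and are not constructed here.

## Tree / Mathlib search

REUSED: `perTrialState`, `perTrialState_isPeriodic`, `le_entropyDensitySup_perTrialState`, `abs_pow_mul_cellMeanEnergy_perTrialState_sub_le` (`PeriodicTrialState`);
`perVarPressure`, `sub_mul_le_perVarPressure`, `perVarPressure_le_log_partitionFn_box`, `cellSiteNorm`, `IsPeriodic.site_norm_le_cellSiteNorm`,
`perVarPressure_eq_varPressure` (`PeriodicVariationalPressure`); `gibbsBoxDensity`, `posDef/trace/parityAut_gibbsBoxDensity`, `vonNeumannEntropy_gibbsBoxDensity_sub`,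
`tendsto_collar_div_pow`, `varPressure_eq_freePressure` (`FermionGibbsVariationalPrinciple`, `FermionFreeBoundaryPressureExists`); `dvd_prod_succ`.

## References

* R. B. Israel, *Convexity in the Theory of Lattice Gases* (1979), §I.1–I.2 and Thm. II.3.1 / II.2 (variational principle; periodic interactions through
  the sublattice). [cite: Israel1979, Thm. I.2.4]
* O. Bratteli, D. W. Robinson, *OAQSM 2* (1997), Thm. 6.2.40. [cite: BratteliRobinsonII1997, Thm. 6.2.40]
* B. Simon, *The Statistical Mechanics of Lattice Gases* I (1993), §III.4. [cite: Simon1993, §III.4]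
-/

noncomputable section

open scoped ComplexOrder BigOperators Matrix.Norms.L2Operator
open Finset Literature.InformationTheory.Entropy

namespace Literature.MathematicalPhysics.QuantumLattice

open Matrix HubbardWave0 Literature.Probability.LatticeModels ThermodynamicLimit
open _root_.Filter
open scoped _root_.Topology

namespace FermionInteraction

variable {d : ℕ} {q : Fin d → ℕ} {Ψ : FermionInteraction d} {R : ℝ}

/-! ### §1. The finite-volume floor and the two-sided window -/

/-- **THE FINITE-VOLUME FLOOR FOR PERIODIC INTERACTIONS**: for `Ψ` Hermitian, even, `q`-periodic of finite range `R` with uniform site norm `S` (`d ≥ 1`),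
every real `β` and every aligned `N ≥ 1`: `(log Re Z_{[0,N)^d} + β Re(Ψ∅))/N^d − |β| col_R(N) S/N^d ≤ P_q(β,Ψ,R)`.
[cite: BratteliRobinsonII1997, Thm. 6.2.40] [cite: Israel1979, Thm. I.2.4] -/
theorem le_perVarPressure_of_box' (hd : 0 < d) (hH : Ψ.IsHermitian) (hE : Ψ.IsEven) (hΨ : Ψ.IsPeriodic q) (hR : Ψ.HasFiniteRange R) {S : ℝ}
    (hS : ∀ y : Site d, ∑ X ∈ (thicken ({y} : Finset (Site d)) R).powerset with y ∈ X, ‖Ψ.Φ X‖ ≤ S) (β : ℝ) {N : ℕ} (hN : 1 ≤ N)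
    (hNq : ∀ i, (q i + 1) ∣ N) :
    (Real.log (Matrix.partitionFn β (Ψ.localHamiltonian (halfOpenBox d N))).re + β * ((Ψ.Φ ∅) ∅ ∅).re) / (N : ℝ) ^ d -
        |β| * ((((thicken (halfOpenBox d N) R \ halfOpenBox d N).card : ℝ) * S) / (N : ℝ) ^ d) ≤
      Ψ.perVarPressure β q R := by
  set ρ := gibbsBoxDensity β Ψ N with hρ
  have hpd := posDef_gibbsBoxDensity hH β N
  have htr := trace_gibbsBoxDensity hH β N
  have hev := parityAut_gibbsBoxDensity hE β N
  rw [← hρ] at hpd htr hev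
  set ν := InfVolFermionState.perTrialState q N hN ρ hev hpd.posSemidef htr with hν
  have hper := InfVolFermionState.perTrialState_isPeriodic q N hN hNq ρ hev hpd.posSemidef htr
  have hSν := InfVolFermionState.le_entropyDensitySup_perTrialState q N hN hNq ρ hev htr hd hpd
  have hEν := InfVolFermionState.abs_pow_mul_cellMeanEnergy_perTrialState_sub_le q N hN hNq ρ hev hpd.posSemidef htr hΨ hR hS
  have hP := Ψ.sub_mul_le_perVarPressure β q R hper
  rw [← hν] at hSν hEν hP
  have hG := vonNeumannEntropy_gibbsBoxDensity_sub hH β N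
  rw [← hρ] at hG
  have hnd : (0 : ℝ) < (N : ℝ) ^ d := by positivity
  set e := InfVolFermionState.cellMeanEnergy q Ψ ν R
  set s := ν.entropyDensitySup
  set T := (Ψ.localHamiltonian (halfOpenBox d N) * ρ).trace.re
  set c := ((Ψ.Φ ∅) ∅ ∅).re
  set K := (((thicken (halfOpenBox d N) R \ halfOpenBox d N).card : ℝ) * S)
  -- `β e ≤ β (T − c)/N^d + |β| K/N^d` from `|N^d e − (T − c)| ≤ K`
  have hβe : β * e ≤ β * ((T - c) / (N : ℝ) ^ d) + |β| * (K / (N : ℝ) ^ d) := by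
    have h := abs_le.1 hEν
    have h1 : e ≤ (T - c) / (N : ℝ) ^ d + K / (N : ℝ) ^ d := by
      rw [← add_div, le_div_iff₀ hnd]; linarith [h.2]
    have h2 : (T - c) / (N : ℝ) ^ d - K / (N : ℝ) ^ d ≤ e := by
      rw [← sub_div, div_le_iff₀ hnd]; linarith [h.1]
    rcases le_or_gt 0 β with hb | hb
    · rw [abs_of_nonneg hb]; nlinarith
    · rw [abs_of_neg hb]; nlinarith
  have hlog : Real.log (Matrix.partitionFn β (Ψ.localHamiltonian (halfOpenBox d N))).re = vonNeumannEntropy ρ - β * T := hG.symm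
  rw [hlog]
  have e1 : (vonNeumannEntropy ρ - β * T + β * c) / (N : ℝ) ^ d - |β| * (K / (N : ℝ) ^ d) =
      vonNeumannEntropy ρ / (N : ℝ) ^ d - (β * ((T - c) / (N : ℝ) ^ d) + |β| * (K / (N : ℝ) ^ d)) := by
    field_simp
    ring
  rw [e1]
  linarith

/-- The floor with the cell site norm `S_q(Ψ,R)` (no extra hypothesis). [cite: BratteliRobinsonII1997, Thm. 6.2.40] -/
theorem le_perVarPressure_of_box (hd : 0 < d) (hH : Ψ.IsHermitian) (hE : Ψ.IsEven) (hΨ : Ψ.IsPeriodic q) (hR : Ψ.HasFiniteRange R) (β : ℝ)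
    {N : ℕ} (hN : 1 ≤ N) (hNq : ∀ i, (q i + 1) ∣ N) :
    (Real.log (Matrix.partitionFn β (Ψ.localHamiltonian (halfOpenBox d N))).re + β * ((Ψ.Φ ∅) ∅ ∅).re) / (N : ℝ) ^ d -
        |β| * ((((thicken (halfOpenBox d N) R \ halfOpenBox d N).card : ℝ) * Ψ.cellSiteNorm q R) / (N : ℝ) ^ d) ≤
      Ψ.perVarPressure β q R :=
  le_perVarPressure_of_box' hd hH hE hΨ hR (hΨ.site_norm_le_cellSiteNorm R) β hN hNq

/-- **TWO-SIDED WINDOW ON THE PERIODIC VARIATIONAL PRESSURE FROM ONE ALIGNED BOX**: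
`|P_q(β,Ψ,R) − (log Re Z_{[0,N)^d} + β Re(Ψ∅))/N^d| ≤ |β| col_R(N) S_q(Ψ)/N^d` (every real `β`, every aligned `N ≥ 1`).
[cite: BratteliRobinsonII1997, Thm. 6.2.40] [cite: Israel1979, Lemma II.3.1] -/
theorem abs_perVarPressure_sub_boxLogPartitionFn_le (hd : 0 < d) (hH : Ψ.IsHermitian) (hE : Ψ.IsEven) (hΨ : Ψ.IsPeriodic q) (hR : Ψ.HasFiniteRange R)
    (β : ℝ) {N : ℕ} (hN : 1 ≤ N) (hNq : ∀ i, (q i + 1) ∣ N) :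
    |Ψ.perVarPressure β q R -
        (Real.log (Matrix.partitionFn β (Ψ.localHamiltonian (halfOpenBox d N))).re + β * ((Ψ.Φ ∅) ∅ ∅).re) / (N : ℝ) ^ d| ≤
      |β| * ((((thicken (halfOpenBox d N) R \ halfOpenBox d N).card : ℝ) * Ψ.cellSiteNorm q R) / (N : ℝ) ^ d) := by
  have hlo := le_perVarPressure_of_box hd hH hE hΨ hR β hN hNq
  have hup := Ψ.perVarPressure_le_log_partitionFn_box hd hH hΨ hR (hΨ.site_norm_le_cellSiteNorm R) β hN hNq
  have hnd : (0 : ℝ) < (N : ℝ) ^ d := by positivity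
  have hup' : Ψ.perVarPressure β q R ≤
      (Real.log (Matrix.partitionFn β (Ψ.localHamiltonian (halfOpenBox d N))).re + β * ((Ψ.Φ ∅) ∅ ∅).re) / (N : ℝ) ^ d +
        |β| * ((((thicken (halfOpenBox d N) R \ halfOpenBox d N).card : ℝ) * Ψ.cellSiteNorm q R) / (N : ℝ) ^ d) := by
    rw [← mul_div_assoc, ← add_div, le_div_iff₀' hnd]
    exact hup
  rw [abs_le]
  constructor <;> linarith

/-- A certified LOWER bound `ℓ ≤ log Re Z_N` on an aligned box is a certified floor on `P_q`. [cite: Israel1979, Lemma II.3.1] -/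
theorem le_perVarPressure_of_le_log_partitionFn (hd : 0 < d) (hH : Ψ.IsHermitian) (hE : Ψ.IsEven) (hΨ : Ψ.IsPeriodic q) (hR : Ψ.HasFiniteRange R)
    (β : ℝ) {N : ℕ} (hN : 1 ≤ N) (hNq : ∀ i, (q i + 1) ∣ N) {ℓ : ℝ} (hℓ : ℓ ≤ Real.log (Matrix.partitionFn β (Ψ.localHamiltonian (halfOpenBox d N))).re) :
    (ℓ + β * ((Ψ.Φ ∅) ∅ ∅).re) / (N : ℝ) ^ d -
        |β| * ((((thicken (halfOpenBox d N) R \ halfOpenBox d N).card : ℝ) * Ψ.cellSiteNorm q R) / (N : ℝ) ^ d) ≤ Ψ.perVarPressure β q R := by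
  refine le_trans ?_ (le_perVarPressure_of_box hd hH hE hΨ hR β hN hNq)
  have hnd : (0 : ℝ) < (N : ℝ) ^ d := by positivity
  have h1 : (ℓ + β * ((Ψ.Φ ∅) ∅ ∅).re) / (N : ℝ) ^ d ≤
      (Real.log (Matrix.partitionFn β (Ψ.localHamiltonian (halfOpenBox d N))).re + β * ((Ψ.Φ ∅) ∅ ∅).re) / (N : ℝ) ^ d :=
    div_le_div_of_nonneg_right (by linarith) hnd.le
  linarith

/-! ### §2. The limit along aligned boxes -/

/-- **THE PERIODIC VARIATIONAL PRINCIPLE AS A LIMIT**: along the aligned boxes `N_k = k·Π_i(q_i+1)`,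
`N_k^{-d} log Re Tr e^{−βH_{[0,N_k)^d}} → P_q(β,Ψ,R)` for EVERY real `β` (`Ψ` Hermitian, even, `q`-periodic, finite range `R`; `d ≥ 1`).
[cite: BratteliRobinsonII1997, Thm. 6.2.40] [cite: Israel1979, Thm. I.2.4] -/
theorem tendsto_boxLogPartitionFn_perVarPressure (hd : 0 < d) (hH : Ψ.IsHermitian) (hE : Ψ.IsEven) (hΨ : Ψ.IsPeriodic q) (hR : Ψ.HasFiniteRange R)
    (β : ℝ) :
    Tendsto (fun k : ℕ => Real.log (Matrix.partitionFn β (Ψ.localHamiltonian (halfOpenBox d (k * ∏ i, (q i + 1))))).re /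
        (((k * ∏ i, (q i + 1) : ℕ) : ℝ) ^ d)) atTop (𝓝 (Ψ.perVarPressure β q R)) := by
  set L := ∏ i, (q i + 1) with hL
  have hL1 : 1 ≤ L := Finset.prod_pos fun j _ => Nat.succ_pos _
  have hLq : ∀ i, (q i + 1) ∣ L := InfVolFermionState.dvd_prod_succ q
  set S := Ψ.cellSiteNorm q R
  set c : ℝ := β * ((Ψ.Φ ∅) ∅ ∅).re with hc
  have hmul : Tendsto (fun k : ℕ => k * L) atTop atTop := tendsto_atTop_mono (fun k => Nat.le_mul_of_pos_right k hL1) tendsto_id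
  have hpow : Tendsto (fun n : ℕ => ((n : ℝ) ^ d)) atTop atTop := by
    have h := (tendsto_natCast_atTop_atTop (R := ℝ)).comp (tendsto_pow_atTop (α := ℕ) (ne_of_gt hd))
    refine h.congr fun n => ?_
    simp
  -- the error terms vanish
  have hc0 : Tendsto (fun k : ℕ => c / (((k * L : ℕ) : ℝ) ^ d)) atTop (𝓝 0) := tendsto_const_nhds.div_atTop (hpow.comp hmul)
  have hcol : Tendsto (fun k : ℕ => |β| * ((((thicken (halfOpenBox d (k * L)) R \ halfOpenBox d (k * L)).card : ℝ) * S) / (((k * L : ℕ) : ℝ) ^ d)))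
      atTop (𝓝 0) := by
    have h := (((tendsto_collar_div_pow hd R).comp hmul).mul_const S).const_mul |β|
    rw [zero_mul, mul_zero] at h
    refine h.congr fun k => ?_
    simp only [Function.comp_apply]
    ring
  -- squeeze: `a_k ∈ [P − c_k − col_k, P − c_k + col_k]`
  have hlow : Tendsto (fun k : ℕ => Ψ.perVarPressure β q R - c / (((k * L : ℕ) : ℝ) ^ d) -
      |β| * ((((thicken (halfOpenBox d (k * L)) R \ halfOpenBox d (k * L)).card : ℝ) * S) / (((k * L : ℕ) : ℝ) ^ d))) atTop
      (𝓝 (Ψ.perVarPressure β q R)) := by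
    have h := (tendsto_const_nhds (x := Ψ.perVarPressure β q R)).sub hc0 |>.sub hcol
    rwa [sub_zero, sub_zero] at h
  have hhigh : Tendsto (fun k : ℕ => Ψ.perVarPressure β q R - c / (((k * L : ℕ) : ℝ) ^ d) +
      |β| * ((((thicken (halfOpenBox d (k * L)) R \ halfOpenBox d (k * L)).card : ℝ) * S) / (((k * L : ℕ) : ℝ) ^ d))) atTop
      (𝓝 (Ψ.perVarPressure β q R)) := by
    have h := (tendsto_const_nhds (x := Ψ.perVarPressure β q R)).sub hc0 |>.add hcol
    rwa [sub_zero, add_zero] at h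
  refine tendsto_of_tendsto_of_tendsto_of_le_of_le' hlow hhigh ?_ ?_
  · filter_upwards [Filter.eventually_ge_atTop 1] with k hk
    have hkL : 1 ≤ k * L := Nat.one_le_iff_ne_zero.2 (Nat.mul_ne_zero (by omega) (by omega))
    have h := abs_perVarPressure_sub_boxLogPartitionFn_le hd hH hE hΨ hR β hkL (fun i => Dvd.dvd.mul_left (hLq i) k)
    have hnd : (0 : ℝ) < (((k * L : ℕ) : ℝ)) ^ d := by positivity
    rw [abs_le, add_div] at h
    linarith [h.2]
  · filter_upwards [Filter.eventually_ge_atTop 1] with k hk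
    have hkL : 1 ≤ k * L := Nat.one_le_iff_ne_zero.2 (Nat.mul_ne_zero (by omega) (by omega))
    have h := abs_perVarPressure_sub_boxLogPartitionFn_le hd hH hE hΨ hR β hkL (fun i => Dvd.dvd.mul_left (hLq i) k)
    rw [abs_le, add_div] at h
    linarith [h.1]

/-- **The periodic variational pressure does not depend on the range parameter** (both are the same limit).
[cite: BratteliRobinsonII1997, Thm. 6.2.40] -/
theorem perVarPressure_eq_of_hasFiniteRange (hd : 0 < d) (hH : Ψ.IsHermitian) (hE : Ψ.IsEven) (hΨ : Ψ.IsPeriodic q) {R R' : ℝ}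
    (hR : Ψ.HasFiniteRange R) (hR' : Ψ.HasFiniteRange R') (β : ℝ) : Ψ.perVarPressure β q R = Ψ.perVarPressure β q R' :=
  tendsto_nhds_unique (tendsto_boxLogPartitionFn_perVarPressure hd hH hE hΨ hR β) (tendsto_boxLogPartitionFn_perVarPressure hd hH hE hΨ hR' β)

/-! ### §3. Consistency with the translation-covariant case -/

/-- For a translation-COVARIANT interaction the periodic principle is the old one: `P_q(β,Ψ) = P_free(β,Ψ)` (`β ≥ 0`).
[cite: BratteliRobinsonII1997, Thm. 6.2.40] -/
theorem perVarPressure_eq_freePressure (hd : 0 < d) (hH : Ψ.IsHermitian) (hE : Ψ.IsEven) (hT : Ψ.IsTranslationInvariant) (hR : Ψ.HasFiniteRange R)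
    {β : ℝ} (hβ : 0 ≤ β) (q : Fin d → ℕ) : Ψ.perVarPressure β q R = Ψ.freePressure β := by
  rw [perVarPressure_eq_varPressure hd β q hT R, varPressure_eq_freePressure hd hH hE hT hR hβ]

end FermionInteraction

end Literature.MathematicalPhysics.QuantumLattice

end
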